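import Literature.NumberTheory.GaloisRepresentations.LubinTateColemanTrace
import Literature.NumberTheory.GaloisRepresentations.LubinTateColemanLevel
import HarnessLib

/-!
# Coleman's trace operator: independence of the level and divisibility by `π`

De Shalit, *Iwasawa theory of elliptic curves with complex multiplication* (1987), Ch. I §3.12: the trace
operator `𝒮` with `(𝒮h) ∘ f = Σ_{ω ∈ W_f^1} h(X [+] ω)` (tree `colemanTrace`, `LubinTateColemanTrace.lean`), and
the remark "for any `h` the right side of (22) [`(1/p) Σ_ζ h(ζ(1+X)-1)`] is an integral power series". For the
Lubin–Tate group of `f = πX + X^q` over a non-archimedean local field `F` (everything **proved**):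

* ★ `colemanTrace_level_eq` — `colemanTrace hπ n = colemanTrace hπ m`: like `𝒩` (`colemanNorm_level_eq`),
  `𝒮` does not depend on the Lubin–Tate field `K_π^{n+1}` in which it is computed (uniqueness of the
  solution of (23), transported along `seriesInclMap`).
* ★ `colemanTrace_mem_coeffIdeal` — **`𝒮h ≡ 0 (mod π)`** for every `h ∈ 𝒪_F⟦X⟧`: `Σ_c h(X [+] ω_c) ≡ q·h ≡ 0`
  modulo `𝔪_{K_π^{n+1}}` (`sum_transl_sub_mem_coeffIdeal`), the congruence descends to `𝒪_F`
  (`mem_coeffIdeal_of_map_mem`) and `f`-substitution reflects it (`mem_coeffIdeal_of_subst_mem`); so the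
  NORMALISED trace `π⁻¹ 𝒮` is integral (`exists_colemanTrace_eq_C_mul`) — de Shalit's `(1/p) Σ` for `Ĝ_m`.

## References

* E. de Shalit, *Iwasawa theory of elliptic curves with complex multiplication* (1987), Ch. I §3.12.
  [cite: deShalit1987, Ch. I §3.12]

## Mathlib reuse

`Equiv.sum_comp`, `PowerSeries.map_injective`; from the tree: `LubinTateColemanTrace.lean` (`colemanTrace`,
`map_subst_colemanTrace`, `nSum`), `LubinTateColemanLevel.lean` (`seriesInclMap_transl`, `seriesInclMap_map`,
`exists_perm_inclPt_ltDivPt`), `LubinTateColeman.lean` (`sum_transl_sub_mem_coeffIdeal`, `subst_injective`,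
`mem_coeffIdeal_of_subst_mem`, `isClosed_ballIdeal_one`), `LubinTateNormOperator.lean`
(`mem_coeffIdeal_of_map_mem`, `natCast_residueFieldCard_mem_maxNilIdeal`).
-/

noncomputable section

open Filter Topology Polynomial ValuativeRel
open scoped PowerSeries.WithPiTopology

namespace Literature.NumberTheory.GaloisRepresentations

section LocalFieldSL

open GaloisRepresentations.IsNonarchimedeanLocalField LubinTate

variable (F : Type*) [Field F] [ValuativeRel F] [TopologicalSpace F] [IsNonarchimedeanLocalField F]

attribute [local instance] ltNormUniformSpace ltNormIsUniformAddGroup rk1 nF nE fintypeResidueField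

variable {F}
variable {π : 𝒪[F]} (hπ : (valuation F).IsUniformizer (π : F))

/-! ### Level independence of `𝒮` -/

/-- ★ **Coleman's trace operator does not depend on the level**: `colemanTrace hπ n h = colemanTrace hπ m h`
for `n ≤ m`. [cite: deShalit1987, Ch. I §3.12] -/
theorem colemanTrace_eq_of_le {n m : ℕ} (hnm : n ≤ m) (h : PowerSeries (LTCoeff F)) :
    colemanTrace hπ n h = colemanTrace hπ m h := by
  have hle : ltField π n ≤ ltField π m := ltField_mono hπ hnm
  have h1 : PowerSeries.map (algebraMap (LTCoeff F) (unitBall (ltField π m)))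
      (PowerSeries.subst (ltSer F π) (colemanTrace hπ n h)) =
      PowerSeries.map (algebraMap (LTCoeff F) (unitBall (ltField π m)))
        (PowerSeries.subst (ltSer F π) (colemanTrace hπ m h)) := by
    rw [map_subst_colemanTrace hπ m h, ← seriesInclMap_map hle, map_subst_colemanTrace hπ n h, nSum, nSum,
      map_sum]
    obtain ⟨τ, hτ⟩ := exists_perm_inclPt_ltDivPt hπ hle
    simp_rw [seriesInclMap_transl, hτ]
    exact Equiv.sum_comp τ (fun c => transl _ (isLTRing_LTCoeff hπ) (isLTSeries_LTCoeff π) (ltDivPt hπ m c) h)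
  have h2 : PowerSeries.subst (ltSer F π) (colemanTrace hπ n h) =
      PowerSeries.subst (ltSer F π) (colemanTrace hπ m h) :=
    PowerSeries.map_injective _ (algebraMap_LTCoeff_injective (ltField π m)) h1
  exact subst_injective (isLTRing_LTCoeff hπ) (isLTSeries_ltSer π) h2

/-- **`colemanTrace hπ n = colemanTrace hπ m`** for all levels. [cite: deShalit1987, Ch. I §3.12] -/
theorem colemanTrace_level_eq (n m : ℕ) (h : PowerSeries (LTCoeff F)) :
    colemanTrace hπ n h = colemanTrace hπ m h := by
  rcases le_total n m with hnm | hmn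
  · exact colemanTrace_eq_of_le hπ hnm h
  · exact (colemanTrace_eq_of_le hπ hmn h).symm

/-! ### `𝒮h ≡ 0 (mod π)` -/

variable (n : ℕ)

/-- The Coleman sum is divisible by `𝔪`: `Σ_c h(X [+] ω_c) ≡ q · h ≡ 0 (mod 𝔪_{K_π^{n+1}})` coefficientwise.
[cite: deShalit1987, Ch. I §3.12] -/
theorem nSum_mem_coeffIdeal (h : PowerSeries (LTCoeff F)) :
    nSum (maxNilIdeal F (ltField π n)) (isLTRing_LTCoeff hπ) (isLTSeries_LTCoeff π) (ltDivPt hπ n) h ∈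
      coeffIdeal (maxNilIdeal F (ltField π n)).toIdeal := by
  have h1 := sum_transl_sub_mem_coeffIdeal (maxNilIdeal F (ltField π n)) (isLTRing_LTCoeff hπ)
    (isLTSeries_LTCoeff π) (ltDivPt hπ n) (maxNilIdeal F (ltField π n)).toIdeal
    (maxNilIdeal F (ltField π n)).isClosed (fun c => (ltDivPt hπ n c).2) h
  have h2 : (Fintype.card 𝓀[F] : PowerSeries (unitBall (ltField π n))) *
      h.map (algebraMap (LTCoeff F) (unitBall (ltField π n))) ∈ coeffIdeal (maxNilIdeal F (ltField π n)).toIdeal := by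
    have hq : ((Fintype.card 𝓀[F] : ℕ) : unitBall (ltField π n)) ∈ (maxNilIdeal F (ltField π n)).toIdeal := by
      rw [show Fintype.card 𝓀[F] = residueFieldCard F by rw [residueFieldCard, Nat.card_eq_fintype_card]]
      exact natCast_residueFieldCard_mem_maxNilIdeal hπ
    rw [← map_natCast (PowerSeries.C (R := unitBall (ltField π n)))]
    exact C_mul_mem_coeffIdeal hq _
  have h3 := add_mem h1 h2
  rwa [sub_add_cancel] at h3

/-- ★ **`𝒮h ≡ 0 (mod π)`** for every `h ∈ 𝒪_F⟦X⟧` (so `π⁻¹ 𝒮h` is integral — de Shalit's normalised trace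
`(1/p) Σ_ζ h(ζ(1+X) - 1)` for `Ĝ_m`). [cite: deShalit1987, Ch. I §3.12] -/
theorem colemanTrace_mem_coeffIdeal (h : PowerSeries (LTCoeff F)) :
    colemanTrace hπ n h ∈ coeffIdeal (Ideal.span {LTCoeff.of F π}) := by
  have hq : residueFieldCard F ≠ 0 := (one_lt_residueFieldCard F).ne_bot
  have h1 : PowerSeries.subst (ltSer F π) (colemanTrace hπ n h) ∈ coeffIdeal (Ideal.span {LTCoeff.of F π}) := by
    refine mem_coeffIdeal_of_map_mem hπ (E := ltField π n) ?_
    rw [map_subst_colemanTrace]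
    exact nSum_mem_coeffIdeal hπ n h
  have h2 : PowerSeries.subst (ltSer F π) (colemanTrace hπ n h) ∈ coeffIdeal (Ideal.span {LTCoeff.of F π ^ 1}) := by
    rwa [pow_one]
  have h3 := mem_coeffIdeal_of_subst_mem (isLTRing_LTCoeff hπ) (isLTSeries_ltSer π) hq 1 h2
  rwa [pow_one] at h3

/-- **The normalised trace is integral**: `𝒮h = π · S₁` for some `S₁ ∈ 𝒪_F⟦X⟧`.
[cite: deShalit1987, Ch. I §3.12] -/
theorem exists_colemanTrace_eq_C_mul (h : PowerSeries (LTCoeff F)) :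
    ∃ S₁ : PowerSeries (LTCoeff F), colemanTrace hπ n h = PowerSeries.C (LTCoeff.of F π) * S₁ :=
  exists_eq_C_mul_of_mem_coeffIdeal_span (colemanTrace_mem_coeffIdeal hπ n h)

end LocalFieldSL

end Literature.NumberTheory.GaloisRepresentations
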